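import Mathlib.NumberTheory.ZetaValues
import Mathlib.NumberTheory.Real.Irrational
import Mathlib.LinearAlgebra.LinearIndependent.Lemmas
import Mathlib.Logic.Equiv.Fin.Basic
import HarnessLib

/-!
# Calegari–Dimitrov–Tang: `1`, `π²` and `L(2, χ₋₃)` are linearly independent over `ℚ`
(family `periods`, trunk `NumberTheory/Transcendental`; named fact, D-0014)

Work item `wi-12199`, wanted by route `KontsevichZagierPeriods/HurwitzMicroSectors` (items
`SectorTwoSix` = stmt-KontsevichZagierPeriods-3870 and `RigidityTwoSix` = stmt-…-3874, which carry
the statement below *verbatim* as an inline hypothesis).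

F. Calegari, V. Dimitrov, Y. Tang, *The linear independence of `1`, `ζ(2)`, and `L(2, χ₋₃)`*,
arXiv:2408.15403 (2024) [CalegariDimitrovTang2024], **Theorem 1** (p. 3): "The period
`L(2, χ₋₃) = ∑_{n=0}^∞ (1/(3n+1)² - 1/(3n+2)²) = 0.7813024128964862968…`
`= ∬_{1 ≥ y ≥ x ≥ 0} dx dy / (y(1 + x + x²)) = -∫₀¹ log(x) dx/(1 + x + x²)` is irrational. More
generally, the three periods `1, π², L(2, χ₋₃)` are linearly independent over `ℚ`." ("The formula
above exhibits `L(2, χ₋₃)` as a period in the sense of Kontsevich–Zagier"; method: arithmetic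
holonomy bounds, not effective linear forms; the `ℚ̄`-version is not claimed.) **Corollary 2**
(p. 3): the numbers `1/1² + 1/4² + 1/7² + ⋯ = L(2,χ₋₃)/2 + 2π²/27`,
`1/2² + 1/5² + 1/8² + ⋯ = -L(2,χ₋₃)/2 + 2π²/27`, `1/1² + 1/7² + 1/13² + ⋯ = 5L(2,χ₋₃)/8 + π²/18`,
`1/5² + 1/11² + 1/17² + ⋯ = -5L(2,χ₋₃)/8 + π²/18` are irrational (values of the trigamma
function `ψ₁(z) = ζ(2, z)` at `z = n/6`).

## Contents

* `L2chi3 : ℝ` — the real number `L(2, χ₋₃)`, *defined* by CDT's series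
  `∑' n : ℕ, (1/(3n+1)² - 1/(3n+2)²)` (glue definition; `[cite: CalegariDimitrovTang2024, Thm. 1]`),
  with the proved API `summable_L2chi3_series`, `hasSum_L2chi3`, `L2chi3_eq_sub`
  (`L(2,χ₋₃) = ∑ 1/(3n+1)² - ∑ 1/(3n+2)²`), `L2chi3_pos`.
* **Named fact** `calegariDimitrovTang_linearIndependent` — Theorem 1, stated *literally* as the
  route's inline hypothesis
  `LinearIndependent ℚ ![(1 : ℝ), Real.pi ^ 2, ∑' n : ℕ, (1/(3n+1)² - 1/(3n+2)²)]` (so that a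
  proof `h` of the fact is a term of that type by `rfl`-unfolding; `…_iff` records the reading with
  `L2chi3`). Not proved here (statement-only fact; the proof is the 137-page paper).
* **Proved consequences** (from the fact as hypothesis `h`): `…irrational_L2chi3` (Theorem 1,
  first clause), the mod-`3` decomposition of `ζ(2) = π²/6` (`tsum_one_div_sq_mod_three`,
  proved unconditionally: `∑ 1/(3n+1)² = L(2,χ₋₃)/2 + 2π²/27`, `∑ 1/(3n+2)² = -L(2,χ₋₃)/2 + 2π²/27`,
  `tsum_one_div_three_mul_add_one_sq`, `tsum_one_div_three_mul_add_two_sq`), and the first two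
  irrationality statements of Corollary 2 (`…irrational_tsum_one_div_three_mul_add_one_sq`,
  `…irrational_tsum_one_div_three_mul_add_two_sq`), and `…irrational_pi_sq`. The mod-`6` lines of
  Corollary 2 and the integral representations are not formalised.

## Design / Mathlib notes

* Mathlib has `hasSum_zeta_two : HasSum (n ↦ 1/n²) (π²/6)` (with the junk term `1/0² = 0`),
  `LinearIndependent`, `Fintype.linearIndependent_iff`, `Irrational`, `Nat.divModEquiv`,
  `HasSum.prod_fiberwise`, `Summable.comp_injective`; it has Dirichlet `L`-functions
  (`DirichletCharacter.LFunction`) but no closed form or irrationality statement for `L(2, χ₋₃)`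
  (`lean search 'chi₃|χ₋₃|L2chi|trigamma'`: nothing relevant). The identification of `L2chi3` with
  `LSeries (n ↦ (n/3)) 2` for the quadratic character modulo `3` is left to a sibling file (cf.
  `CatalanConstantBeta.lean` for `L(2, χ₄)`).
* The mod-`3` decomposition is obtained by reindexing `hasSum_zeta_two` along
  `Fin 3 × ℕ ≃ ℕ`, `(r, k) ↦ 3k + r` (`Nat.divModEquiv 3`) and summing fiberwise
  (`HasSum.prod_fiberwise`); the fiber `r = 0` is `∑ 1/(3k)² = π²/54`.
-/

noncomputable section

open Filter Real

namespace Literature.NumberTheory.Transcendental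

/-! ### The number `L(2, χ₋₃)` -/

/-- **`L(2, χ₋₃)`** as a real number, defined by the series of Calegari–Dimitrov–Tang's Theorem 1:
`L(2, χ₋₃) = ∑_{n ≥ 0} (1/(3n+1)² - 1/(3n+2)²) = 0.7813024128964862968…` (the value at `s = 2` of
the Dirichlet `L`-function of the odd quadratic character of conductor `3`; glue definition, the
term-wise difference being absolutely summable). [cite: CalegariDimitrovTang2024, Thm. 1 (p. 3)] -/
def L2chi3 : ℝ :=
  ∑' n : ℕ, (1 / (3 * (n : ℝ) + 1) ^ 2 - 1 / (3 * (n : ℝ) + 2) ^ 2)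

/-- The terms `1/(3k + r)²` form a summable family: a subfamily of `∑ 1/n²`
(`hasSum_zeta_two`) along the injection `k ↦ 3k + r`. [folklore] -/
theorem summable_one_div_three_mul_add_sq (r : ℕ) :
    Summable fun k : ℕ => 1 / (3 * (k : ℝ) + r) ^ 2 := by
  have h := hasSum_zeta_two.summable.comp_injective
    (i := fun k : ℕ => k * 3 + r) (fun a b hab => by simpa using hab)
  refine h.congr fun k => ?_
  simp only [Function.comp_apply]
  push_cast
  ring_nf

/-- `∑_{k ≥ 0} 1/(3k+1)²` converges. [folklore] -/
theorem summable_one_div_three_mul_add_one_sq :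
    Summable fun k : ℕ => 1 / (3 * (k : ℝ) + 1) ^ 2 := by
  simpa using summable_one_div_three_mul_add_sq 1

/-- `∑_{k ≥ 0} 1/(3k+2)²` converges. [folklore] -/
theorem summable_one_div_three_mul_add_two_sq :
    Summable fun k : ℕ => 1 / (3 * (k : ℝ) + 2) ^ 2 := by
  simpa using summable_one_div_three_mul_add_sq 2

/-- The defining series of `L2chi3` is summable. [cite: CalegariDimitrovTang2024, Thm. 1 (p. 3)] -/
theorem summable_L2chi3_series :
    Summable fun n : ℕ => 1 / (3 * (n : ℝ) + 1) ^ 2 - 1 / (3 * (n : ℝ) + 2) ^ 2 :=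
  summable_one_div_three_mul_add_one_sq.sub summable_one_div_three_mul_add_two_sq

/-- The defining series of `L2chi3` sums to it. [cite: CalegariDimitrovTang2024, Thm. 1 (p. 3)] -/
theorem hasSum_L2chi3 :
    HasSum (fun n : ℕ => 1 / (3 * (n : ℝ) + 1) ^ 2 - 1 / (3 * (n : ℝ) + 2) ^ 2) L2chi3 :=
  summable_L2chi3_series.hasSum

/-- `L(2, χ₋₃) = ∑_{n ≥ 0} 1/(3n+1)² - ∑_{n ≥ 0} 1/(3n+2)²` (both series converge).
[cite: CalegariDimitrovTang2024, Thm. 1 and Cor. 2 (p. 3)] -/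
theorem L2chi3_eq_sub :
    L2chi3 = (∑' n : ℕ, 1 / (3 * (n : ℝ) + 1) ^ 2) - ∑' n : ℕ, 1 / (3 * (n : ℝ) + 2) ^ 2 :=
  (summable_one_div_three_mul_add_one_sq.hasSum.sub
    summable_one_div_three_mul_add_two_sq.hasSum).tsum_eq

/-- `L(2, χ₋₃) > 0` (every term `1/(3n+1)² - 1/(3n+2)²` is positive).
[cite: CalegariDimitrovTang2024, Thm. 1 (p. 3: `= 0.7813…`)] -/
theorem L2chi3_pos : 0 < L2chi3 := by
  have hterm : ∀ n : ℕ, 0 < 1 / (3 * (n : ℝ) + 1) ^ 2 - 1 / (3 * (n : ℝ) + 2) ^ 2 := by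
    intro n
    have h0 : (0 : ℝ) ≤ n := n.cast_nonneg
    rw [sub_pos]
    apply one_div_lt_one_div_of_lt
    · positivity
    · nlinarith
  exact summable_L2chi3_series.tsum_pos (fun n => (hterm n).le) 0 (hterm 0)

/-! ### The named fact: Calegari–Dimitrov–Tang, Theorem 1 -/

/-- **Calegari–Dimitrov–Tang 2024, Theorem 1** (named fact, D-0014; statement only): "the three
periods `1, π², L(2, χ₋₃)` are linearly independent over `ℚ`", with
`L(2, χ₋₃) = ∑_{n ≥ 0} (1/(3n+1)² - 1/(3n+2)²)`. Written literally as the inline hypothesis of the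
route items `SectorTwoSix` / `RigidityTwoSix` (`Summits/KontsevichZagierPeriods/…/HurwitzMicroSectors`),
so that a proof of this `Prop` *is* a term of that hypothesis type; `L2chi3` unfolds to the third
entry (`calegariDimitrovTang_linearIndependent_iff`). Over `ℚ` only: linear independence over `ℚ̄`
is not claimed in print. Proof in print: arithmetic holonomy bounds (arXiv:2408.15403, §§2–13);
no proof is attempted here. [cite: CalegariDimitrovTang2024, Thm. 1 (p. 3)] -/
def calegariDimitrovTang_linearIndependent : Prop :=
  LinearIndependent ℚ
    ![(1 : ℝ), Real.pi ^ 2, (∑' n : ℕ, (1 / (3 * (n : ℝ) + 1) ^ 2 - 1 / (3 * (n : ℝ) + 2) ^ 2))]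

/-- The named fact read with the glue constant `L2chi3` (definitional).
[cite: CalegariDimitrovTang2024, Thm. 1 (p. 3)] -/
theorem calegariDimitrovTang_linearIndependent_iff :
    calegariDimitrovTang_linearIndependent ↔
      LinearIndependent ℚ ![(1 : ℝ), Real.pi ^ 2, L2chi3] :=
  Iff.rfl

/-- Coefficient extraction: under Theorem 1, a rational relation `p + q π² + r L(2,χ₋₃) = 0` is
trivial. [cite: CalegariDimitrovTang2024, Thm. 1 (p. 3)] -/
theorem calegariDimitrovTang_linearIndependent.eq_zero (h : calegariDimitrovTang_linearIndependent)
    (p q r : ℚ) (hrel : (p : ℝ) + q * Real.pi ^ 2 + r * L2chi3 = 0) : p = 0 ∧ q = 0 ∧ r = 0 := by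
  have h3 := Fintype.linearIndependent_iff.mp (calegariDimitrovTang_linearIndependent_iff.mp h)
    ![p, q, r] (by
      rw [Fin.sum_univ_three]
      simp only [Matrix.cons_val_zero, Matrix.cons_val_one, Matrix.cons_val, Rat.smul_def,
        mul_one]
      exact hrel)
  exact ⟨h3 0, h3 1, h3 2⟩

/-- **Theorem 1, first clause**: `L(2, χ₋₃)` is irrational (from the linear independence: a value
`q ∈ ℚ` would give the relation `q · 1 + 0 · π² - L(2,χ₋₃) = 0`).
[cite: CalegariDimitrovTang2024, Thm. 1 (p. 3)] -/
theorem calegariDimitrovTang_linearIndependent.irrational_L2chi3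
    (h : calegariDimitrovTang_linearIndependent) : Irrational L2chi3 := by
  rintro ⟨q, hq⟩
  have := (h.eq_zero q 0 (-1) (by rw [← hq]; push_cast; ring)).2.2
  norm_num at this

/-! ### The mod-`3` decomposition of `ζ(2)` and Corollary 2 -/

/-- **`ζ(2)` split along residues mod `3`**:
`π²/54 + ∑_{k ≥ 0} 1/(3k+1)² + ∑_{k ≥ 0} 1/(3k+2)² = π²/6` (the three fibers of `∑ 1/n² = π²/6`,
`hasSum_zeta_two`, along `(r, k) ↦ 3k + r`; the fiber `r = 0` is `∑ 1/(3k)² = ζ(2)/9`).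
[cite: CalegariDimitrovTang2024, Cor. 2 (p. 3)] -/
theorem tsum_one_div_sq_mod_three :
    Real.pi ^ 2 / 54 + (∑' k : ℕ, 1 / (3 * (k : ℝ) + 1) ^ 2) + ∑' k : ℕ, 1 / (3 * (k : ℝ) + 2) ^ 2 =
      Real.pi ^ 2 / 6 := by
  -- reindex `∑ 1/n²` along `Fin 3 × ℕ ≃ ℕ`, `(r, k) ↦ 3k + r`
  let e : Fin 3 × ℕ ≃ ℕ := (Equiv.prodComm (Fin 3) ℕ).trans (Nat.divModEquiv 3).symm
  have he : ∀ p : Fin 3 × ℕ, e p = p.2 * 3 + (p.1 : ℕ) := fun p => rfl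
  have hζ : HasSum (fun p : Fin 3 × ℕ => (1 : ℝ) / ((p.2 * 3 + (p.1 : ℕ) : ℕ) : ℝ) ^ 2)
      (Real.pi ^ 2 / 6) := by
    have h := (e.hasSum_iff (f := fun n : ℕ => (1 : ℝ) / (n : ℝ) ^ 2)).mpr hasSum_zeta_two
    simpa only [Function.comp_def, he] using h
  -- the three fibers
  let T : Fin 3 → ℝ := ![Real.pi ^ 2 / 54, ∑' k : ℕ, 1 / (3 * (k : ℝ) + 1) ^ 2,
    ∑' k : ℕ, 1 / (3 * (k : ℝ) + 2) ^ 2]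
  have hfib : ∀ r : Fin 3,
      HasSum (fun k : ℕ => (1 : ℝ) / ((k * 3 + (r : ℕ) : ℕ) : ℝ) ^ 2) (T r) := by
    intro r
    fin_cases r
    · -- `r = 0`: `∑ 1/(3k)² = π²/54`
      have hfun : (fun k : ℕ => (1 : ℝ) / ((k * 3 + 0 : ℕ) : ℝ) ^ 2) =
          fun k : ℕ => 1 / 9 * (1 / (k : ℝ) ^ 2) := by
        funext k
        push_cast
        ring
      have hval : Real.pi ^ 2 / 54 = 1 / 9 * (Real.pi ^ 2 / 6) := by ring
      change HasSum (fun k : ℕ => (1 : ℝ) / ((k * 3 + 0 : ℕ) : ℝ) ^ 2) (Real.pi ^ 2 / 54)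
      rw [hfun, hval]
      exact hasSum_zeta_two.mul_left (1 / 9)
    · have hfun : (fun k : ℕ => (1 : ℝ) / ((k * 3 + 1 : ℕ) : ℝ) ^ 2) =
          fun k : ℕ => 1 / (3 * (k : ℝ) + 1) ^ 2 := by
        funext k
        push_cast
        ring
      change HasSum (fun k : ℕ => (1 : ℝ) / ((k * 3 + 1 : ℕ) : ℝ) ^ 2)
        (∑' k : ℕ, 1 / (3 * (k : ℝ) + 1) ^ 2)
      rw [hfun]
      exact summable_one_div_three_mul_add_one_sq.hasSum
    · have hfun : (fun k : ℕ => (1 : ℝ) / ((k * 3 + 2 : ℕ) : ℝ) ^ 2) =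
          fun k : ℕ => 1 / (3 * (k : ℝ) + 2) ^ 2 := by
        funext k
        push_cast
        ring
      change HasSum (fun k : ℕ => (1 : ℝ) / ((k * 3 + 2 : ℕ) : ℝ) ^ 2)
        (∑' k : ℕ, 1 / (3 * (k : ℝ) + 2) ^ 2)
      rw [hfun]
      exact summable_one_div_three_mul_add_two_sq.hasSum
  have hsum : HasSum T (Real.pi ^ 2 / 6) := hζ.prod_fiberwise hfib
  have huniq := hsum.unique (hasSum_fintype T)
  rw [Fin.sum_univ_three] at huniq
  simpa only [T, Matrix.cons_val_zero, Matrix.cons_val_one, Matrix.cons_val, add_assoc]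
    using huniq.symm

/-- **Corollary 2, line 1 (the value)**: `1/1² + 1/4² + 1/7² + ⋯ = L(2, χ₋₃)/2 + 2π²/27`.
[cite: CalegariDimitrovTang2024, Cor. 2 (p. 3)] -/
theorem tsum_one_div_three_mul_add_one_sq :
    ∑' k : ℕ, 1 / (3 * (k : ℝ) + 1) ^ 2 = L2chi3 / 2 + 2 * Real.pi ^ 2 / 27 := by
  have h := tsum_one_div_sq_mod_three
  rw [L2chi3_eq_sub]
  linarith

/-- **Corollary 2, line 2 (the value)**: `1/2² + 1/5² + 1/8² + ⋯ = -L(2, χ₋₃)/2 + 2π²/27`.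
[cite: CalegariDimitrovTang2024, Cor. 2 (p. 3)] -/
theorem tsum_one_div_three_mul_add_two_sq :
    ∑' k : ℕ, 1 / (3 * (k : ℝ) + 2) ^ 2 = -(L2chi3 / 2) + 2 * Real.pi ^ 2 / 27 := by
  have h := tsum_one_div_sq_mod_three
  rw [L2chi3_eq_sub]
  linarith

/-- **Corollary 2, line 1**: `1/1² + 1/4² + 1/7² + 1/10² + ⋯ = ψ₁(1/3)/9` is irrational (from
Theorem 1: it is `L(2,χ₋₃)/2 + 2π²/27` with a non-zero coefficient of `L(2,χ₋₃)`).
[cite: CalegariDimitrovTang2024, Cor. 2 (p. 3)] -/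
theorem calegariDimitrovTang_linearIndependent.irrational_tsum_one_div_three_mul_add_one_sq
    (h : calegariDimitrovTang_linearIndependent) :
    Irrational (∑' k : ℕ, 1 / (3 * (k : ℝ) + 1) ^ 2) := by
  rw [tsum_one_div_three_mul_add_one_sq]
  rintro ⟨q, hq⟩
  have := (h.eq_zero q (-(2 / 27)) (-(1 / 2)) (by push_cast; linarith)).2.2
  norm_num at this

/-- **Corollary 2, line 2**: `1/2² + 1/5² + 1/8² + 1/11² + ⋯ = ψ₁(2/3)/9` is irrational.
[cite: CalegariDimitrovTang2024, Cor. 2 (p. 3)] -/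
theorem calegariDimitrovTang_linearIndependent.irrational_tsum_one_div_three_mul_add_two_sq
    (h : calegariDimitrovTang_linearIndependent) :
    Irrational (∑' k : ℕ, 1 / (3 * (k : ℝ) + 2) ^ 2) := by
  rw [tsum_one_div_three_mul_add_two_sq]
  rintro ⟨q, hq⟩
  have := (h.eq_zero q (-(2 / 27)) (1 / 2) (by push_cast; linarith)).2.2
  norm_num at this

/-- Also recorded in Theorem 1's list of periods: `π²` is irrational (here from the fact; known
unconditionally since Legendre 1794, and in Mathlib for `π` itself). [cite: CalegariDimitrovTang2024, Thm. 1 and Cor. 2 (p. 3, "Legendre's proof in 1794 that π² is irrational")] -/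
theorem calegariDimitrovTang_linearIndependent.irrational_pi_sq
    (h : calegariDimitrovTang_linearIndependent) : Irrational (Real.pi ^ 2) := by
  rintro ⟨q, hq⟩
  have := (h.eq_zero q (-1) 0 (by rw [← hq]; push_cast; ring)).2.1
  norm_num at this

end Literature.NumberTheory.Transcendental
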